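import Mathlib
import Summits.ResolutionOfSingularities.ResolutionOfSingularities.Theorems.HomologicalConductorPersistenceDoubleDoubleCoverCentre
import Summits.ResolutionOfSingularities.ResolutionOfSingularities.Theorems.HomologicalConductorPersistenceQuotientAscent
import HarnessLib

/-!
# Lifting `ca` through a double branched cover WITHOUT the named fact: `π⁻¹(ca(R)) ⊆ ca(R♯)`
# (W4.4b K-C3 §H2L: the `⊇`-half of [Esentepe2020, Thm. 5.4] in the kernel, via quotient ascent)

Route `ResolutionOfSingularities/HomologicalConductor`, chain W4.4b (cell `res-hironaka`), crux `Persistence`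
(stmt-ResolutionOfSingularities-16484), KILL CANDIDATE K-C3 (res-L1-w44b-plan-1 g13 13:03:18Z GO; res-type-011 RE-PLAN 13:42Z).
[OURS; AI-written, weaker than expert review; NOT a statement of the manuscript under study (Hironaka 2017); NO named fact is used
in this file — everything is PROVED.]

res-L1-w44b-stub-2's QUOTIENT ASCENT (`QuotientAscent.comap_cohomologyAnnihilator_quotient_le`, p531707): for a noetherian ring
`R♯` and `a ∈ R♯` a non-zero-divisor lying in `ca(R♯)`, `ca(R♯/(a))` pulls back into `ca(R♯)`.  For the double branched cover
`R♯ = S⟦y⟧/(f + y²) → R = S/(f)` (`BranchedCover S f 2`, `branchedCoverProjection`; [Esentepe2020, §5.1]) take `a = ȳ`: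
`ȳ` is a non-zero-divisor (`S` a domain, `f ≠ 0`), `ȳ ∈ ca(R♯)` (Jacobian: `∂(f + y²)/∂y = 2y`, part 2 `mk_X_mem_cohomologyAnnihilator`,
PROVED), and `R♯/(ȳ) ≅ R` (`ker π = (ȳ)`, part 2).  Hence:

* `mk_X_mem_nonZeroDivisors` — `ȳ ∈ (S⟦y⟧/(C f + yᵐ))⁰` for `S` a domain, `f ≠ 0`, `m ≠ 0`;
* `comap_branchedCoverProjection_le_cohomologyAnnihilator` — GENERIC: `ȳ` a non-zero-divisor in `ca(R♯)` ⇒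
  `π⁻¹(ca(R)) ⊆ ca(R♯)`;
* `comap_branchedCoverProjection_le_cohomologyAnnihilator_mvPowerSeries` — base `S = k⟦x₁,…,xₙ⟧`, `char k ≠ 2`, `0 ≠ f`:
  **`π⁻¹(ca(S/(f))) ⊆ ca(S⟦y⟧/(f + y²))`** — the `⊇`-HALF of [Esentepe2020, Thm. 5.4] (`m = 2`), now a THEOREM of the tree;
  `…_of_ringEquiv` — the same over any base `S′ ≃+* k⟦x₁,…,xₙ⟧` (for the second cover step);
* `comap_comp_le_cohomologyAnnihilator_doubleDoubleCover` — the iterate: `(π₁ ∘ π₂)⁻¹(ca(C)) ⊆ ca(T)` for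
  `T = k⟦x₁..xₙ⟧⟦u⟧⟦v⟧/(g + u² + v²)`, `C = k⟦x₁..xₙ⟧/(g)` (`g ≠ 0`; no `g ∈ 𝔪` needed);
* **`span_sup_map_le_cohomologyAnnihilator_of_le`** — with part 4's pure-algebra identity
  `(π₁ ∘ π₂)⁻¹(J₀·C) = (v̄, ū) ⊔ J₀·T`: **`J₀·C ≤ ca(C) ⇒ (v̄, ū) ⊔ J₀·T ≤ ca(T)`** — the K-C3 LOWER BOUND at the completed stage
  with hypotheses `char k ≠ 2`, `0 ≠ g ∈ 𝔪` and the curve-side bound only; plane-curve / `−h` forms.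

So the K2-LOWER half of K-C3 no longer depends on [Esentepe2020, Thm. 5.4] at all; with the fact-free curve-side bound
(`…ConductorStablyAnnihilates` / res-L1-w44b-stub-2's `…ConductorStable` + res-L1-w44b-stub-1's `Cusp34` normalisation) KC3Facts = ∅
for K2.  Filed `--supports stmt-ResolutionOfSingularities-16484 --as helper`.
-/

noncomputable section

-- single-problem summit: the doubled namespace component `ResolutionOfSingularities` is forced
set_option linter.dupNamespace false

namespace Summit.ResolutionOfSingularities.ResolutionOfSingularities.Theorems.HomologicalConductor.PersistenceBranchedCoverLift

open PowerSeries Literature.RingTheory.CohomologyAnnihilator Literature.AlgebraicGeometry.Resolution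
open scoped nonZeroDivisors
open Summit.ResolutionOfSingularities.ResolutionOfSingularities.Theorems.HomologicalConductor.PersistenceBranchedCover
open Summit.ResolutionOfSingularities.ResolutionOfSingularities.Theorems.HomologicalConductor.PersistenceBranchedCoverIterate
open Summit.ResolutionOfSingularities.ResolutionOfSingularities.Theorems.HomologicalConductor.PersistenceDoubleDoubleCoverCentre
open Summit.ResolutionOfSingularities.ResolutionOfSingularities.Theorems.HomologicalConductor.QuotientAscent

universe u

/-! ## `ȳ` is a non-zero-divisor -/

/-- **`ȳ` is a non-zero-divisor of `S⟦y⟧/(C f + yᵐ)`** when `S` is a domain, `f ≠ 0` and `m ≠ 0`: if `y·g = h·(C f + yᵐ)` then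
the constant coefficient of `h` vanishes (`S` a domain), so `h = y·h′` and `g = h′·(C f + yᵐ)`. [folklore] -/
theorem mk_X_mem_nonZeroDivisors {S : Type u} [CommRing S] [IsDomain S] (f : S) (hf : f ≠ 0) (m : ℕ) [NeZero m] :
    Ideal.Quotient.mk (Ideal.span {(C f + X ^ m : PowerSeries S)}) X ∈ (BranchedCover S f m)⁰ := by
  suffices key : ∀ z : BranchedCover S f m, Ideal.Quotient.mk _ X * z = 0 → z = 0 from
    mem_nonZeroDivisors_iff.mpr ⟨key, fun z hz => key z (by rwa [mul_comm])⟩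
  intro z hz
  obtain ⟨g, rfl⟩ := Ideal.Quotient.mk_surjective z
  rw [← map_mul, Ideal.Quotient.eq_zero_iff_mem, Ideal.mem_span_singleton'] at hz
  obtain ⟨h, hh⟩ := hz
  -- constant coefficients: `constantCoeff h * f = 0`
  have h0 : constantCoeff h = 0 := by
    have := congrArg constantCoeff hh
    rw [map_mul, map_mul, map_add, map_pow, constantCoeff_C, constantCoeff_X, zero_pow (NeZero.ne m), add_zero,
      zero_mul] at this
    exact (mul_eq_zero.mp this).resolve_right hf
  obtain ⟨h', rfl⟩ := X_dvd_iff.mpr h0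
  rw [Ideal.Quotient.eq_zero_iff_mem, Ideal.mem_span_singleton']
  refine ⟨h', ?_⟩
  have hX : (X : PowerSeries S) ≠ 0 := X_ne_zero
  apply mul_left_cancel₀ hX
  rw [← hh]
  ring

/-! ## The generic lifting lemma -/

/-- **LIFTING OF `ca` THROUGH THE DOUBLE COVER, generic form**: for the cover `π : R♯ = S⟦y⟧/(C f + yᵐ) → R = S/(f)` over a
noetherian ring `S` (`m ≠ 0`), IF `ȳ` is a non-zero-divisor of `R♯` lying in `ca(R♯)` THEN `π⁻¹(ca(R)) ⊆ ca(R♯)`.  Proof: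
`R♯/(ȳ) ≅ R` along `π` (`ker π = (ȳ)`, `π` onto), so `π c ∈ ca(R)` puts the class of `c` in `ca(R♯/(ȳ))`
(`cohomologyAnnihilator_eq_comap_ringEquiv`), and res-L1-w44b-stub-2's quotient ascent
`QuotientAscent.comap_cohomologyAnnihilator_quotient_le` (PROVED: [IyengarTakahashi2014, Rem. 2.12] + Dao–Takahashi) lifts it to
`c ∈ ca(R♯)`. [folklore] -/
theorem comap_branchedCoverProjection_le_cohomologyAnnihilator {S : Type u} [CommRing S] [IsNoetherianRing S] (f : S)
    (m : ℕ) [NeZero m]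
    (hnzd : Ideal.Quotient.mk (Ideal.span {(C f + X ^ m : PowerSeries S)}) X ∈ (BranchedCover S f m)⁰)
    (hy : Ideal.Quotient.mk (Ideal.span {(C f + X ^ m : PowerSeries S)}) X ∈ cohomologyAnnihilator (BranchedCover S f m)) :
    (cohomologyAnnihilator (S ⧸ Ideal.span {f})).comap (branchedCoverProjection S f m) ≤
      cohomologyAnnihilator (BranchedCover S f m) := by
  set ybar := Ideal.Quotient.mk (Ideal.span {(C f + X ^ m : PowerSeries S)}) X with hybar
  haveI : IsNoetherianRing (BranchedCover S f m) := Ideal.Quotient.isNoetherianRing _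
  -- `R♯/(ȳ) ≅ R` along `π`
  have hker : RingHom.ker (branchedCoverProjection S f m) = Ideal.span {ybar} := ker_branchedCoverProjection f m
  let ε : (BranchedCover S f m ⧸ Ideal.span {ybar}) ≃+* (S ⧸ Ideal.span {f}) :=
    (Ideal.quotEquivOfEq hker.symm).trans
      (RingHom.quotientKerEquivOfSurjective (branchedCoverProjection_surjective f m))
  have hε : ∀ c : BranchedCover S f m, ε (Ideal.Quotient.mk _ c) = branchedCoverProjection S f m c := fun c => rfl
  intro c hc
  rw [Ideal.mem_comap] at hc
  refine comap_cohomologyAnnihilator_quotient_le hnzd hy (Ideal.mem_comap.mpr ?_)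
  rw [cohomologyAnnihilator_eq_comap_ringEquiv ε, Ideal.mem_comap]
  change ε (Ideal.Quotient.mk _ c) ∈ _
  rw [hε]
  exact hc

/-! ## Base `k⟦x₁,…,xₙ⟧` and bases isomorphic to it -/

/-- **THE `⊇`-HALF OF [Esentepe2020, Thm. 5.4] (`m = 2`) AS A THEOREM**: for `S = k⟦x₁,…,xₙ⟧`, `char k ≠ 2`, `0 ≠ f ∈ S`:
`π⁻¹(ca(S/(f))) ⊆ ca(S⟦y⟧/(f + y²))` — `ȳ ∈ ca(R♯)` by the Jacobian mechanism (part 2, res-D-pv-058's derivation lemma) and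
`ȳ` is a non-zero-divisor. (No `f ∈ 𝔪` hypothesis is needed.) [cite: Esentepe2020, Theorem 5.4 (⊇ half, proved)] -/
theorem comap_branchedCoverProjection_le_cohomologyAnnihilator_mvPowerSeries (k : Type u) [Field k] (hchar : ringChar k ≠ 2)
    (n : ℕ) (f : MvPowerSeries (Fin n) k) (hf0 : f ≠ 0) :
    (cohomologyAnnihilator (MvPowerSeries (Fin n) k ⧸ Ideal.span {f})).comap (branchedCoverProjection (MvPowerSeries (Fin n) k) f 2) ≤
      cohomologyAnnihilator (BranchedCover (MvPowerSeries (Fin n) k) f 2) := by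
  haveI : IsDomain (MvPowerSeries (Fin n) k) := NoZeroDivisors.to_isDomain _
  haveI := isRegularLocalRing_mvPowerSeries k (Fin n)
  haveI : IsNoetherianRing (MvPowerSeries (Fin n) k) := inferInstance
  exact comap_branchedCoverProjection_le_cohomologyAnnihilator f 2 (mk_X_mem_nonZeroDivisors f hf0 2)
    (mk_X_mem_cohomologyAnnihilator k hchar n f)

/-- Power series and their quotient covers are functorial in ring isomorphisms of the base: `e : S′ ≃+* S` induces
`E : BranchedCover S′ f′ m ≃+* BranchedCover S (e f′) m` with `E ȳ = ȳ` and `E (C s)‾ = (C (e s))‾`, compatibly with the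
projections. (Extracted from part 3.) [folklore] -/
theorem exists_branchedCover_ringEquiv_of_ringEquiv {S' S : Type u} [CommRing S'] [CommRing S] (e : S' ≃+* S) (f' : S')
    (m : ℕ) [NeZero m] :
    ∃ E : BranchedCover S' f' m ≃+* BranchedCover S (e f') m,
      E (Ideal.Quotient.mk _ X) = Ideal.Quotient.mk _ X ∧
      (∀ a : PowerSeries S', E (Ideal.Quotient.mk _ a) = Ideal.Quotient.mk _ (PowerSeries.map (e : S' →+* S) a)) ∧
      ∀ c : BranchedCover S' f' m,
        branchedCoverProjection S (e f') m (E c) =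
          Ideal.quotientEquiv (Ideal.span {f'}) (Ideal.span {e f'}) e
            (by rw [Ideal.map_span, Set.image_singleton, RingHom.coe_coe]) (branchedCoverProjection S' f' m c) := by
  let Pe : PowerSeries S' ≃+* PowerSeries S :=
    RingEquiv.ofRingHom (PowerSeries.map (e : S' →+* S)) (PowerSeries.map (e.symm : S →+* S'))
      (by rw [← PowerSeries.map_comp, RingEquiv.comp_symm]; exact RingHom.ext (congrFun map_id))
      (by rw [← PowerSeries.map_comp, RingEquiv.symm_comp]; exact RingHom.ext (congrFun map_id))
  have hPe : ∀ a : PowerSeries S', Pe a = PowerSeries.map (e : S' →+* S) a := fun a => rfl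
  have hPe_gen : Pe (C f' + X ^ m) = C (e f') + X ^ m := by
    rw [hPe, map_add, map_pow, PowerSeries.map_C, PowerSeries.map_X]; rfl
  have hIJ : Ideal.span {(C (e f') + X ^ m : PowerSeries S)} =
      (Ideal.span {(C f' + X ^ m : PowerSeries S')}).map (Pe : PowerSeries S' →+* PowerSeries S) := by
    rw [Ideal.map_span, Set.image_singleton, RingHom.coe_coe, hPe_gen]
  refine ⟨Ideal.quotientEquiv _ _ Pe hIJ, ?_, fun a => rfl, fun c => ?_⟩
  · change Ideal.Quotient.mk _ (Pe X) = _
    rw [hPe, PowerSeries.map_X]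
  · obtain ⟨a, rfl⟩ := Ideal.Quotient.mk_surjective c
    change branchedCoverProjection S (e f') m (Ideal.Quotient.mk _ (Pe a)) = _
    rw [branchedCoverProjection_mk, branchedCoverProjection_mk, hPe, ← coeff_zero_eq_constantCoeff_apply, coeff_map,
      coeff_zero_eq_constantCoeff_apply]
    rfl

/-- The `⊇`-half over any base `S′` isomorphic to `k⟦x₁,…,xₙ⟧` (`e f′ ≠ 0`; for the second step of the iterated cover, with
`S′ = k⟦x₁..xₙ⟧⟦u⟧ ≅ k⟦x₁..xₙ₊₁⟧`). [cite: Esentepe2020, Theorem 5.4 (⊇ half, proved)] -/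
theorem comap_branchedCoverProjection_le_cohomologyAnnihilator_of_ringEquiv (k : Type u) [Field k] (hchar : ringChar k ≠ 2)
    (n : ℕ) {S' : Type u} [CommRing S'] (e : S' ≃+* MvPowerSeries (Fin n) k) (f' : S') (hf0 : f' ≠ 0) :
    (cohomologyAnnihilator (S' ⧸ Ideal.span {f'})).comap (branchedCoverProjection S' f' 2) ≤
      cohomologyAnnihilator (BranchedCover S' f' 2) := by
  haveI : IsDomain (MvPowerSeries (Fin n) k) := NoZeroDivisors.to_isDomain _
  haveI := isRegularLocalRing_mvPowerSeries k (Fin n)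
  haveI : IsNoetherianRing (MvPowerSeries (Fin n) k) := inferInstance
  haveI : IsDomain S' := e.toMulEquiv.isDomain  -- transport
  haveI : IsNoetherianRing S' := isNoetherianRing_of_ringEquiv _ e.symm
  have hef : e f' ≠ 0 := fun h => hf0 (by simpa using congrArg e.symm h)
  obtain ⟨E, hEX, -, -⟩ := exists_branchedCover_ringEquiv_of_ringEquiv e f' 2
  -- `ȳ' ∈ ca(R'♯)` by transport from `ȳ ∈ ca(R♯)`
  have hy' : Ideal.Quotient.mk (Ideal.span {(C f' + X ^ 2 : PowerSeries S')}) X ∈ cohomologyAnnihilator (BranchedCover S' f' 2) := by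
    rw [cohomologyAnnihilator_eq_comap_ringEquiv E, Ideal.mem_comap]
    change E (Ideal.Quotient.mk _ X) ∈ _
    rw [hEX]
    exact mk_X_mem_cohomologyAnnihilator k hchar n (e f')
  exact comap_branchedCoverProjection_le_cohomologyAnnihilator f' 2 (mk_X_mem_nonZeroDivisors f' hf0 2) hy'

/-! ## The iterated cover: `(π₁ ∘ π₂)⁻¹(ca(C)) ⊆ ca(T)` and the K-C3 lower bound -/

/-- **Iterated lifting**: for `S = k⟦x₁,…,xₙ⟧`, `char k ≠ 2`, `0 ≠ g ∈ 𝔪_S`, `C = S/(g)`, `T = S⟦u⟧⟦v⟧/(g + u² + v²)`: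
`(π₁ ∘ π₂)⁻¹(ca(C)) ⊆ ca(T)` (twice the `⊇`-half; the second time over the base `S⟦u⟧ ≅ k⟦x₁..xₙ₊₁⟧`).
[cite: Esentepe2020, Theorem 5.4 (⊇ half, proved)] -/
theorem comap_comp_le_cohomologyAnnihilator_doubleDoubleCover (k : Type u) [Field k] (hchar : ringChar k ≠ 2) (n : ℕ)
    (g : MvPowerSeries (Fin n) k) (hg0 : g ≠ 0) :
    (cohomologyAnnihilator (MvPowerSeries (Fin n) k ⧸ Ideal.span {g})).comap
        ((branchedCoverProjection (MvPowerSeries (Fin n) k) g 2).comp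
          (branchedCoverProjection (PowerSeries (MvPowerSeries (Fin n) k))
            (C g + X ^ 2 : PowerSeries (MvPowerSeries (Fin n) k)) 2)) ≤
      cohomologyAnnihilator
        (BranchedCover (PowerSeries (MvPowerSeries (Fin n) k)) (C g + X ^ 2 : PowerSeries (MvPowerSeries (Fin n) k)) 2) := by
  obtain ⟨e⟩ := nonempty_powerSeries_ringEquiv_mvPowerSeries k n
  haveI : IsDomain (MvPowerSeries (Fin n) k) := NoZeroDivisors.to_isDomain _
  have hF0 : (C g + X ^ 2 : PowerSeries (MvPowerSeries (Fin n) k)) ≠ 0 :=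
    nonZeroDivisors.ne_zero (generator_mem_nonZeroDivisors g)
  rw [← Ideal.comap_comap]
  refine le_trans (Ideal.comap_mono
    (comap_branchedCoverProjection_le_cohomologyAnnihilator_mvPowerSeries k hchar n g hg0)) ?_
  exact comap_branchedCoverProjection_le_cohomologyAnnihilator_of_ringEquiv k hchar (n + 1) e (C g + X ^ 2) hF0

/-- **THE K-C3 LOWER BOUND AT THE COMPLETED STAGE, FACT-FREE ON THE THREEFOLD SIDE**: for `S = k⟦x₁,…,xₙ⟧`, `char k ≠ 2`,
`0 ≠ g ∈ 𝔪_S`, any ideal `J₀ ≤ S` with `J₀·C ≤ ca(C)` (`C = S/(g)`): `(v̄, ū) ⊔ J₀·T ≤ ca(T)` for `T = S⟦u⟧⟦v⟧/(g + u² + v²)`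
(part 4's identity `(π₁ ∘ π₂)⁻¹(J₀·C) = (v̄, ū) ⊔ J₀·T` + the iterated lifting). [folklore] -/
theorem span_sup_map_le_cohomologyAnnihilator_of_le (k : Type u) [Field k] (hchar : ringChar k ≠ 2) (n : ℕ)
    (g : MvPowerSeries (Fin n) k) (hg0 : g ≠ 0) (J₀ : Ideal (MvPowerSeries (Fin n) k))
    (hJ : J₀.map (Ideal.Quotient.mk (Ideal.span {g})) ≤ cohomologyAnnihilator (MvPowerSeries (Fin n) k ⧸ Ideal.span {g})) :
    Ideal.span {Ideal.Quotient.mk (Ideal.span {(C (C g + X ^ 2 : PowerSeries (MvPowerSeries (Fin n) k)) + X ^ 2 :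
            PowerSeries (PowerSeries (MvPowerSeries (Fin n) k)))}) X,
          Ideal.Quotient.mk (Ideal.span {(C (C g + X ^ 2 : PowerSeries (MvPowerSeries (Fin n) k)) + X ^ 2 :
            PowerSeries (PowerSeries (MvPowerSeries (Fin n) k)))}) (C X)} ⊔
        J₀.map ((Ideal.Quotient.mk (Ideal.span {(C (C g + X ^ 2 : PowerSeries (MvPowerSeries (Fin n) k)) + X ^ 2 :
            PowerSeries (PowerSeries (MvPowerSeries (Fin n) k)))})).comp
          ((C (R := PowerSeries (MvPowerSeries (Fin n) k))).comp (C (R := MvPowerSeries (Fin n) k)))) ≤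
      cohomologyAnnihilator
        (BranchedCover (PowerSeries (MvPowerSeries (Fin n) k)) (C g + X ^ 2 : PowerSeries (MvPowerSeries (Fin n) k)) 2) := by
  rw [← comap_proj_map_eq_span_sup_map g J₀]
  exact le_trans (Ideal.comap_mono hJ) (comap_comp_le_cohomologyAnnihilator_doubleDoubleCover k hchar n g hg0)

/-- **Plane-curve form** (`n = 2`, `J₀ = (z, t)²`): `(z,t)²·C ≤ ca(C) ⇒ (v̄, ū) ⊔ (z̄², z̄·t̄, t̄²) ≤ ca(k⟦z,t⟧⟦u⟧⟦v⟧/(g + u² + v²))`.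
[folklore] -/
theorem span_sup_span_le_cohomologyAnnihilator_planeCurve_of_le (k : Type u) [Field k] (hchar : ringChar k ≠ 2)
    (g : MvPowerSeries (Fin 2) k) (hg0 : g ≠ 0)
    (hJ : ((Ideal.span {(MvPowerSeries.X 0 : MvPowerSeries (Fin 2) k), MvPowerSeries.X 1}) ^ 2).map
        (Ideal.Quotient.mk (Ideal.span {g})) ≤ cohomologyAnnihilator (MvPowerSeries (Fin 2) k ⧸ Ideal.span {g})) :
    Ideal.span {Ideal.Quotient.mk (Ideal.span {(C (C g + X ^ 2 : PowerSeries (MvPowerSeries (Fin 2) k)) + X ^ 2 :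
            PowerSeries (PowerSeries (MvPowerSeries (Fin 2) k)))}) X,
          Ideal.Quotient.mk (Ideal.span {(C (C g + X ^ 2 : PowerSeries (MvPowerSeries (Fin 2) k)) + X ^ 2 :
            PowerSeries (PowerSeries (MvPowerSeries (Fin 2) k)))}) (C X)} ⊔
      Ideal.span {Ideal.Quotient.mk (Ideal.span {(C (C g + X ^ 2 : PowerSeries (MvPowerSeries (Fin 2) k)) + X ^ 2 :
            PowerSeries (PowerSeries (MvPowerSeries (Fin 2) k)))}) (C (C (MvPowerSeries.X 0 ^ 2))),
          Ideal.Quotient.mk (Ideal.span {(C (C g + X ^ 2 : PowerSeries (MvPowerSeries (Fin 2) k)) + X ^ 2 :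
            PowerSeries (PowerSeries (MvPowerSeries (Fin 2) k)))}) (C (C (MvPowerSeries.X 0 * MvPowerSeries.X 1))),
          Ideal.Quotient.mk (Ideal.span {(C (C g + X ^ 2 : PowerSeries (MvPowerSeries (Fin 2) k)) + X ^ 2 :
            PowerSeries (PowerSeries (MvPowerSeries (Fin 2) k)))}) (C (C (MvPowerSeries.X 1 ^ 2)))} ≤
      cohomologyAnnihilator
        (BranchedCover (PowerSeries (MvPowerSeries (Fin 2) k)) (C g + X ^ 2 : PowerSeries (MvPowerSeries (Fin 2) k)) 2) := by
  have h := span_sup_map_le_cohomologyAnnihilator_of_le k hchar 2 g hg0 _ hJ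
  rw [span_pair_sq, Ideal.map_span, Set.image_insert_eq, Set.image_insert_eq, Set.image_singleton] at h
  exact h

/-- **`−h` sign form** (the chain's `xy − h` convention, `x = u + iv`, `y = u − iv`): `(z,t)²·(S/(h)) ≤ ca(S/(h)) ⇒
(v̄, ū) ⊔ (z̄², z̄·t̄, t̄²) ≤ ca(k⟦z,t⟧⟦u⟧⟦v⟧/(−h + u² + v²))`. [folklore] -/
theorem span_sup_span_le_cohomologyAnnihilator_planeCurve_neg_of_le (k : Type u) [Field k] (hchar : ringChar k ≠ 2)
    (h : MvPowerSeries (Fin 2) k) (hh0 : h ≠ 0)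
    (hJ : ((Ideal.span {(MvPowerSeries.X 0 : MvPowerSeries (Fin 2) k), MvPowerSeries.X 1}) ^ 2).map
        (Ideal.Quotient.mk (Ideal.span {h})) ≤ cohomologyAnnihilator (MvPowerSeries (Fin 2) k ⧸ Ideal.span {h})) :
    Ideal.span {Ideal.Quotient.mk (Ideal.span {(C (C (-h) + X ^ 2 : PowerSeries (MvPowerSeries (Fin 2) k)) + X ^ 2 :
            PowerSeries (PowerSeries (MvPowerSeries (Fin 2) k)))}) X,
          Ideal.Quotient.mk (Ideal.span {(C (C (-h) + X ^ 2 : PowerSeries (MvPowerSeries (Fin 2) k)) + X ^ 2 :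
            PowerSeries (PowerSeries (MvPowerSeries (Fin 2) k)))}) (C X)} ⊔
      Ideal.span {Ideal.Quotient.mk (Ideal.span {(C (C (-h) + X ^ 2 : PowerSeries (MvPowerSeries (Fin 2) k)) + X ^ 2 :
            PowerSeries (PowerSeries (MvPowerSeries (Fin 2) k)))}) (C (C (MvPowerSeries.X 0 ^ 2))),
          Ideal.Quotient.mk (Ideal.span {(C (C (-h) + X ^ 2 : PowerSeries (MvPowerSeries (Fin 2) k)) + X ^ 2 :
            PowerSeries (PowerSeries (MvPowerSeries (Fin 2) k)))}) (C (C (MvPowerSeries.X 0 * MvPowerSeries.X 1))),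
          Ideal.Quotient.mk (Ideal.span {(C (C (-h) + X ^ 2 : PowerSeries (MvPowerSeries (Fin 2) k)) + X ^ 2 :
            PowerSeries (PowerSeries (MvPowerSeries (Fin 2) k)))}) (C (C (MvPowerSeries.X 1 ^ 2)))} ≤
      cohomologyAnnihilator
        (BranchedCover (PowerSeries (MvPowerSeries (Fin 2) k)) (C (-h) + X ^ 2 : PowerSeries (MvPowerSeries (Fin 2) k)) 2) := by
  refine span_sup_span_le_cohomologyAnnihilator_planeCurve_of_le k hchar (-h) (neg_ne_zero.mpr hh0) ?_
  have hI : Ideal.span {-h} = Ideal.span {h} := Ideal.span_singleton_neg h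
  -- transfer `hJ` along the equality of ideals
  revert hJ
  generalize Ideal.span {h} = I at hI ⊢
  subst hI
  exact id

end Summit.ResolutionOfSingularities.ResolutionOfSingularities.Theorems.HomologicalConductor.PersistenceBranchedCoverLift

end
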